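import Literature.NumberTheory.EllipticCurves.KatoDivisibilityExceptionalZeroSkeletonProofs
import Literature.NumberTheory.EllipticCurves.KatoDivisibilityColemanKernelSkeletonProofs
import HarnessLib

/-!
# Kato 2004 (Astérisque 295) §17.13 at an EXCEPTIONAL-ZERO prime with the Coleman map injective
# only UP TO `c`-TORSION: `T · char_Λ X ∣ p^m · L` from the `Δ`-descended inputs

Topic `NumberTheory/EllipticCurves` (sibling of `KatoDivisibilityExceptionalZeroSkeletonProofs`,
`KatoDivisibilityColemanKernelSkeletonProofs`). Cell `bsd-2adic` (rung K4 of `BirchSwinnertonDyer`,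
class O1 = X5 at `p = 2`), seat `bsd-2adic-mult` GEN 10, HOME `run/shared/lean/pub/bsd-2adic/`
(memo `mult/KERNEL-K11-COLEMAN-DESCENT-ADDENDUM-2.md` §S1). HONEST FRAMING: PROVED commutative
algebra only (no named fact); it is the kernel half that a future «print over `ℚ₂(ζ_{2^∞})` +
descent» presentation of Kato's inputs at a SPLIT multiplicative `2` needs — after the `Δ = {±1}`
descent the Coleman map keeps a kernel killed by `2` (`Kato2004.two_smul_eq_zero_of_descent`), so the
exceptional-zero bookkeeping of `exists_X_mul_mem_charIdeal_of_skeleton_exceptional` (which assumes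
`Injective col`) must be re-run with `col y = 0 ⇒ c • y = 0`. BSD is not advanced; nothing is booked.

## What is proved

* `Kato2004.lengthAt_quotient_range_add_le_of_range_le_kerUpTo` — p. 280's bookkeeping with the
  Coleman map valued in an ideal `J` and `Ker(col)` killed by `c ∉ 𝔭`:
  `length(P/loc H)_𝔭 + length(H/Z)_𝔭 + length(R/J)_𝔭 ≤ length(R/(G))_𝔭`.
* `Kato2004.lengthAt_add_le_of_skeleton_exceptional_kerUpTo` — Thm. 17.4 (2)'s shape at one prime
  at an exceptional-zero prime: `length X_𝔭 + length(R/J)_𝔭 ≤ length(R/(G))_𝔭`.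
* `Kato2004.exists_X_mul_mem_charIdeal_of_skeleton_exceptional_kerUpTo` — over `Λ = ℤ_p⟦T⟧`:
  `X` torsion and `ι(T · g) = p^m · L`, `g ∈ char_Λ X`, for `col(P) ⊆ (T)`, `L(0) = 0`, and `col`
  injective up to `c`-torsion with `c` outside every height-one `𝔭 ∌ p` (e.g. `c = 2·p^a`,
  `Kato2004.two_mul_natCast_pow_ne_zero_and_not_mem`).

## References

* K. Kato, Astérisque 295 (2004): Thm. 12.5 (3) (p. 222), Thm. 17.4 (1)(2) (p. 273), §17.13
  (pp. 279–280), 14.9 (p. 239). [Kato2004Asterisque]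
* C. Wuthrich, Doc. Math. 19 (2014), Cor. 19 (p. 398; the shape `I · char X ∣ (L_p)`). [Wuthrich2014]
* Tree: `KatoDivisibilityExceptionalZeroSkeletonProofs` (the `Injective col` version,
  `lengthAt_range_add_le_of_upTo`), `KatoDivisibilityColemanKernelSkeletonProofs`
  (`isTorsion_of_skeleton_kerUpTo`, `Module.lengthAt_le_of_smul_ker_eq_zero`),
  `KatoDivisibilitySkeletonProofs` (`loc_injective`).
-/

noncomputable section

namespace Literature.NumberTheory.EllipticCurves

namespace Kato2004

open Module

/-! ### Over an arbitrary domain -/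

section Exceptional

variable {R : Type*} [CommRing R] [IsDomain R]
  {H P X H2 H2loc : Type*} [AddCommGroup H] [_root_.Module R H] [AddCommGroup P]
  [_root_.Module R P] [AddCommGroup X] [_root_.Module R X] [AddCommGroup H2] [_root_.Module R H2]
  [AddCommGroup H2loc] [_root_.Module R H2loc]

omit [IsDomain R] in
/-- **The bookkeeping of p. 280 with the Coleman map valued in an ideal `J` and injective up to
`c`-torsion.** With `loc : H ↪ P` injective, `col y = 0 ⇒ c • y = 0`, `c ∉ 𝔭`, `col(P) ⊆ J` and
`G ∈ col(loc Z)`: `length(P/loc H)_𝔭 + length(H/Z)_𝔭 + length(R/J)_𝔭 ≤ length(R/(G))_𝔭` — as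
`lengthAt_quotient_range_add_le_of_range_le`, the step `P/loc Z → J/col(loc Z)` now having a kernel
killed by `c` (invisible at `𝔭`). [cite: Kato2004Asterisque, §17.13 (p. 280)] [cite: Wuthrich2014, Cor. 19 (p. 398; shape)] -/
theorem lengthAt_quotient_range_add_le_of_range_le_kerUpTo (loc : H →ₗ[R] P)
    (hinj : Function.Injective loc) (col : P →ₗ[R] R) {c : R}
    (hcol : ∀ y : P, col y = 0 → c • y = 0) {J : Ideal R} (hJ : ∀ y : P, col y ∈ J)
    (Z : Submodule R H) {G : R} (hGZ : G ∈ Submodule.map (col ∘ₗ loc) Z) (𝔭 : PrimeSpectrum R)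
    (hc : c ∉ 𝔭.asIdeal) :
    lengthAt R (P ⧸ LinearMap.range loc) 𝔭 + lengthAt R (H ⧸ Z) 𝔭 + lengthAt R (R ⧸ J) 𝔭 ≤
      lengthAt R (R ⧸ Ideal.span {G}) 𝔭 := by
  obtain ⟨z, hzZ, hz⟩ := Submodule.mem_map.mp hGZ
  simp only [LinearMap.coe_comp, Function.comp_apply] at hz
  set LZ : Submodule R P := Submodule.map loc Z with hLZ
  have hLZle : LZ ≤ LinearMap.range loc := LinearMap.map_le_range
  set N : Submodule R (P ⧸ LZ) := Submodule.map LZ.mkQ (LinearMap.range loc) with hN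
  have hQN : lengthAt R (P ⧸ LZ) 𝔭 = lengthAt R N 𝔭 + lengthAt R ((P ⧸ LZ) ⧸ N) 𝔭 :=
    lengthAt_eq_add_quotient N 𝔭
  have hthird : lengthAt R ((P ⧸ LZ) ⧸ N) 𝔭 = lengthAt R (P ⧸ LinearMap.range loc) 𝔭 :=
    lengthAt_eq_of_linearEquiv (Submodule.quotientQuotientEquivQuotient LZ _ hLZle) 𝔭
  have hNeq : lengthAt R N 𝔭 = lengthAt R (H ⧸ Z) 𝔭 := by
    set g : H →ₗ[R] P ⧸ LZ := LZ.mkQ ∘ₗ loc with hg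
    have hrange : LinearMap.range g = N := by
      rw [hg, LinearMap.range_comp, hN]
    have hker : LinearMap.ker g = Z := by
      rw [hg, LinearMap.ker_comp, Submodule.ker_mkQ, hLZ, Submodule.comap_map_eq_of_injective hinj]
    calc lengthAt R N 𝔭 = lengthAt R (LinearMap.range g) 𝔭 := by rw [hrange]
      _ = lengthAt R (H ⧸ LinearMap.ker g) 𝔭 :=
          (lengthAt_eq_of_linearEquiv g.quotKerEquivRange 𝔭).symm
      _ = lengthAt R (H ⧸ Z) 𝔭 := by rw [hker]
  -- the ideal `I = col(loc Z) ⊆ J`, containing `G`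
  set I : Ideal R := Submodule.map col LZ with hI
  have hGI : G ∈ I := ⟨loc z, ⟨z, hzZ, rfl⟩, hz⟩
  have hIJ : I ≤ J := by
    rintro _ ⟨y, -, rfl⟩
    exact hJ y
  set J' : Submodule R (R ⧸ I) := Submodule.map I.mkQ J with hJ'
  -- `P / LZ → J'` with kernel killed by `c`
  have hQI : lengthAt R (P ⧸ LZ) 𝔭 ≤ lengthAt R J' 𝔭 := by
    set φ : (P ⧸ LZ) →ₗ[R] R ⧸ I := Submodule.mapQ LZ I col fun y hy => ⟨y, hy, rfl⟩ with hφ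
    have hφker : ∀ q : P ⧸ LZ, φ q = 0 → c • q = 0 := by
      intro q hq
      obtain ⟨y, rfl⟩ := Submodule.Quotient.mk_surjective LZ q
      have hy : col y ∈ I := by
        rw [hφ, Submodule.mapQ_apply, Submodule.Quotient.mk_eq_zero] at hq
        exact hq
      obtain ⟨w, hw, hwy⟩ := hy
      have hk : col (y - w) = 0 := by rw [map_sub, hwy, sub_self]
      have hcy : c • (y - w) = 0 := hcol _ hk
      rw [← Submodule.Quotient.mk_smul, Submodule.Quotient.mk_eq_zero]
      rw [smul_sub, sub_eq_zero] at hcy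
      rw [hcy]
      exact LZ.smul_mem c hw
    have hφmem : ∀ q : P ⧸ LZ, φ q ∈ J' := by
      intro q
      obtain ⟨y, rfl⟩ := LZ.mkQ_surjective q
      exact ⟨col y, hJ y, rfl⟩
    refine lengthAt_le_of_smul_ker_eq_zero (LinearMap.codRestrict J' φ hφmem) 𝔭 hc ?_
    intro q hq
    exact hφker q (by simpa using congrArg Subtype.val hq)
  have hsplit : lengthAt R (R ⧸ I) 𝔭 = lengthAt R J' 𝔭 + lengthAt R (R ⧸ J) 𝔭 := by
    rw [lengthAt_eq_add_quotient J' 𝔭,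
      lengthAt_eq_of_linearEquiv (Submodule.quotientQuotientEquivQuotient I J hIJ) 𝔭]
  have hIG : lengthAt R (R ⧸ I) 𝔭 ≤ lengthAt R (R ⧸ Ideal.span {G}) 𝔭 :=
    lengthAt_le_of_surjective (Submodule.factor ((Ideal.span_singleton_le_iff_mem I).mpr hGI))
      (Submodule.factor_surjective _) 𝔭
  calc lengthAt R (P ⧸ LinearMap.range loc) 𝔭 + lengthAt R (H ⧸ Z) 𝔭 + lengthAt R (R ⧸ J) 𝔭
        = lengthAt R (P ⧸ LZ) 𝔭 + lengthAt R (R ⧸ J) 𝔭 := by rw [hQN, hthird, hNeq]; ring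
    _ ≤ lengthAt R J' 𝔭 + lengthAt R (R ⧸ J) 𝔭 := add_le_add hQI le_rfl
    _ = lengthAt R (R ⧸ I) 𝔭 := hsplit.symm
    _ ≤ lengthAt R (R ⧸ Ideal.span {G}) 𝔭 := hIG

/-- **Kato's Thm. 17.4 (2)-shape at ONE prime, at an exceptional-zero prime, Coleman map injective up to
`c`-torsion (skeleton over a domain).** As `lengthAt_add_le_of_skeleton_exceptional` with
`Injective col` weakened to `col y = 0 ⇒ c • y = 0`: at a prime `𝔭 ∌ c` with `length(H2loc)_𝔭 < ∞`
and the PRINTED bound of Thm. 12.5 (3) (error term included),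
`length X_𝔭 + length(R/J)_𝔭 ≤ length(R/(G))_𝔭`.
[cite: Kato2004Asterisque, Thm. 12.5 (3) (p. 222), §17.13 (pp. 279–280), 14.9 (p. 239)] [cite: Wuthrich2014, Cor. 19 (p. 398; shape)] -/
theorem lengthAt_add_le_of_skeleton_exceptional_kerUpTo [Module.IsTorsionFree R H]
    (hrank : Module.rank R H ≤ 1) {c : R} (loc : H →ₗ[R] P) (toX : P →ₗ[R] X) (δ : X →ₗ[R] H2)
    (ε : H2 →ₗ[R] H2loc) (hPX : ∀ h : H, c • toX (loc h) = 0)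
    (hXH : ∀ x : X, δ x = 0 → c • x ∈ LinearMap.range toX) (hH2 : ∀ x : X, c • ε (δ x) = 0)
    (hcoker : ∀ y : H2loc, c • y ∈ LinearMap.range ε) (col : P →ₗ[R] R)
    (hcol : ∀ y : P, col y = 0 → c • y = 0) {J : Ideal R} (hJ : ∀ y : P, col y ∈ J)
    (Z : Submodule R H) {G : R} (hG : G ≠ 0) (hGZ : G ∈ Submodule.map (col ∘ₗ loc) Z)
    (𝔭 : PrimeSpectrum R) (hc : c ∉ 𝔭.asIdeal) (hfin : lengthAt R H2loc 𝔭 ≠ ⊤)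
    (hES : lengthAt R H2 𝔭 ≤ lengthAt R (H ⧸ Z) 𝔭 + lengthAt R H2loc 𝔭) :
    lengthAt R X 𝔭 + lengthAt R (R ⧸ J) 𝔭 ≤ lengthAt R (R ⧸ Ideal.span {G}) 𝔭 := by
  obtain ⟨z, -, hz⟩ := Submodule.mem_map.mp hGZ
  simp only [LinearMap.coe_comp, Function.comp_apply] at hz
  have hinj : Function.Injective loc := loc_injective hrank loc col hG hz
  have h1 : lengthAt R X 𝔭 ≤
      lengthAt R (LinearMap.range toX) 𝔭 + lengthAt R (LinearMap.range δ) 𝔭 := by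
    refine lengthAt_le_add_of_smul_ker_le δ.rangeRestrict (LinearMap.range toX) 𝔭 hc
      fun x hx => hXH x ?_
    simpa using congrArg Subtype.val hx
  have h2 : lengthAt R (LinearMap.range δ) 𝔭 ≤ lengthAt R (H ⧸ Z) 𝔭 := by
    have h := (lengthAt_range_add_le_of_upTo δ ε 𝔭 hc hH2 hcoker).trans hES
    exact (WithTop.add_le_add_iff_right hfin).mp h
  have h3 : lengthAt R (LinearMap.range toX) 𝔭 ≤ lengthAt R (P ⧸ LinearMap.range loc) 𝔭 := by
    rw [← lengthAt_eq_of_linearEquiv toX.quotKerEquivRange 𝔭]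
    refine lengthAt_quotient_le_of_smul_mem 𝔭 hc ?_
    rintro _ ⟨h, rfl⟩
    rw [LinearMap.mem_ker, map_smul]
    exact hPX h
  calc lengthAt R X 𝔭 + lengthAt R (R ⧸ J) 𝔭
      ≤ lengthAt R (P ⧸ LinearMap.range loc) 𝔭 + lengthAt R (H ⧸ Z) 𝔭 +
          lengthAt R (R ⧸ J) 𝔭 := add_le_add (h1.trans (add_le_add h3 h2)) le_rfl
    _ ≤ lengthAt R (R ⧸ Ideal.span {G}) 𝔭 :=
        lengthAt_quotient_range_add_le_of_range_le_kerUpTo loc hinj col hcol hJ Z hGZ 𝔭 hc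

end Exceptional

/-! ### Over `Λ = ℤ_p⟦T⟧`: `T · char_Λ X ∣ p^m · L` -/

section Iwasawa

variable (p : ℕ) [Fact p.Prime]
  {H P X H2 H2loc : Type*} [AddCommGroup H] [_root_.Module (IwasawaAlgebra p) H]
  [AddCommGroup P] [_root_.Module (IwasawaAlgebra p) P]
  [AddCommGroup X] [_root_.Module (IwasawaAlgebra p) X]
  [AddCommGroup H2] [_root_.Module (IwasawaAlgebra p) H2]
  [AddCommGroup H2loc] [_root_.Module (IwasawaAlgebra p) H2loc]

/-- An element `G` of `Λ = ℤ_p⟦T⟧` whose image in `ℚ_p⟦T⟧` is `p^n · L` with `L(0) = 0` is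
divisible by `T`: `G = T · G₁`. [folklore] -/
private theorem exists_eq_X_mul_of_constantCoeff_eq_zero' {G : IwasawaAlgebra p}
    {L : PowerSeries ℚ_[p]} {n : ℕ}
    (hιG : iwasawaToPowerSeries p G = PowerSeries.C ((p : ℚ_[p]) ^ n) * L)
    (hL0 : PowerSeries.constantCoeff L = 0) :
    ∃ G₁ : IwasawaAlgebra p, G = PowerSeries.X * G₁ := by
  have h0 : PowerSeries.constantCoeff (iwasawaToPowerSeries p G) = 0 := by
    rw [hιG, map_mul, PowerSeries.constantCoeff_C, hL0, mul_zero]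
  have hG0 : PowerSeries.constantCoeff G = 0 := by
    rw [← PowerSeries.coeff_zero_eq_constantCoeff_apply, PowerSeries.coeff_map,
      PowerSeries.coeff_zero_eq_constantCoeff_apply, map_eq_zero_iff _
        (IsFractionRing.injective ℤ_[p] ℚ_[p])] at h0
    exact h0
  exact PowerSeries.X_dvd_iff.mpr hG0

/-- **Kato's Thm. 17.4 (1)(2)-shape at an EXCEPTIONAL-ZERO prime for `Λ = ℤ_p⟦T⟧`, in the tree's
form `T · char_Λ X ∣ p^m · L`, with the Coleman map injective only up to `c`-torsion.** As
`exists_X_mul_mem_charIdeal_of_skeleton_exceptional` (file `KatoDivisibilityExceptionalZeroSkeletonProofs`)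
with `Injective col` weakened to `col y = 0 ⇒ c • y = 0` for a `c ≠ 0` lying in no height-one
`𝔭 ∌ p` (the `Δ`-descended Coleman map at `p = 2`: `c = 2·p^a`): `X` is `Λ`-torsion and
`ι(T · g) = p^m · L` for some `m` and some `g ∈ char_Λ X`.
[cite: Kato2004Asterisque, Thm. 12.5 (3) (p. 222), Thm. 17.4 (1)(2) (p. 273), §17.13 (pp. 279–280), 14.9 (p. 239)]
[cite: Wuthrich2014, Cor. 19 (p. 398) (I · char X ∣ (L_p), odd p; shape)] -/
theorem exists_X_mul_mem_charIdeal_of_skeleton_exceptional_kerUpTo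
    [Module.Finite (IwasawaAlgebra p) X]
    [Module.IsTorsionFree (IwasawaAlgebra p) H] (hrank : Module.rank (IwasawaAlgebra p) H ≤ 1)
    {c : IwasawaAlgebra p} (hc0 : c ≠ 0)
    (hc : ∀ 𝔭 : PrimeSpectrum (IwasawaAlgebra p), 𝔭.asIdeal.height = 1 →
      PowerSeries.C (p : ℤ_[p]) ∉ 𝔭.asIdeal → c ∉ 𝔭.asIdeal)
    (loc : H →ₗ[IwasawaAlgebra p] P) (toX : P →ₗ[IwasawaAlgebra p] X)
    (δ : X →ₗ[IwasawaAlgebra p] H2) (ε : H2 →ₗ[IwasawaAlgebra p] H2loc)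
    (hPX : ∀ h : H, c • toX (loc h) = 0)
    (hXH : ∀ x : X, δ x = 0 → c • x ∈ LinearMap.range toX)
    (hH2 : ∀ x : X, c • ε (δ x) = 0) (hcoker : ∀ y : H2loc, c • y ∈ LinearMap.range ε)
    (col : P →ₗ[IwasawaAlgebra p] IwasawaAlgebra p)
    (hcol : ∀ y : P, col y = 0 → c • y = 0)
    (hJ : ∀ y : P, col y ∈ Ideal.span {(PowerSeries.X : IwasawaAlgebra p)})
    (hH2t : Module.IsTorsion (IwasawaAlgebra p) H2)
    (Z : Submodule (IwasawaAlgebra p) H) {G : IwasawaAlgebra p} (hG : G ≠ 0)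
    (hGZ : G ∈ Submodule.map (col ∘ₗ loc) Z)
    (hfin : ∀ 𝔭 : PrimeSpectrum (IwasawaAlgebra p), 𝔭.asIdeal.height = 1 →
      PowerSeries.C (p : ℤ_[p]) ∉ 𝔭.asIdeal → lengthAt (IwasawaAlgebra p) H2loc 𝔭 ≠ ⊤)
    (hES : ∀ 𝔭 : PrimeSpectrum (IwasawaAlgebra p), 𝔭.asIdeal.height = 1 →
      PowerSeries.C (p : ℤ_[p]) ∉ 𝔭.asIdeal →
        lengthAt (IwasawaAlgebra p) H2 𝔭 ≤
          lengthAt (IwasawaAlgebra p) (H ⧸ Z) 𝔭 + lengthAt (IwasawaAlgebra p) H2loc 𝔭)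
    {L : PowerSeries ℚ_[p]} {n : ℕ}
    (hιG : iwasawaToPowerSeries p G = PowerSeries.C ((p : ℚ_[p]) ^ n) * L)
    (hL0 : PowerSeries.constantCoeff L = 0) :
    Module.IsTorsion (IwasawaAlgebra p) X ∧
      ∃ (m : ℕ) (g : IwasawaAlgebra p), g ∈ charIdeal (IwasawaAlgebra p) X ∧
        iwasawaToPowerSeries p (PowerSeries.X * g) = PowerSeries.C ((p : ℚ_[p]) ^ m) * L := by
  obtain ⟨z, -, hz⟩ := Submodule.mem_map.mp hGZ
  simp only [LinearMap.coe_comp, Function.comp_apply] at hz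
  have htors : Module.IsTorsion (IwasawaAlgebra p) X :=
    isTorsion_of_skeleton_kerUpTo hc0 loc toX δ hPX hXH col hcol hG hz hH2t
  refine ⟨htors, ?_⟩
  obtain ⟨G₁, hG₁⟩ := exists_eq_X_mul_of_constantCoeff_eq_zero' p hιG hL0
  have hG₁0 : G₁ ≠ 0 := by
    rintro rfl
    exact hG (by rw [hG₁, mul_zero])
  have hX0 : (PowerSeries.X : IwasawaAlgebra p) ≠ 0 := PowerSeries.X_ne_zero
  have hlen : ∀ 𝔭 : PrimeSpectrum (IwasawaAlgebra p), 𝔭.asIdeal.height = 1 →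
      PowerSeries.C (p : ℤ_[p]) ∉ 𝔭.asIdeal →
        lengthAt (IwasawaAlgebra p) X 𝔭 ≤
          lengthAt (IwasawaAlgebra p) (IwasawaAlgebra p ⧸ Ideal.span {G₁}) 𝔭 := by
    intro 𝔭 h1 hp𝔭
    have h := lengthAt_add_le_of_skeleton_exceptional_kerUpTo hrank loc toX δ ε hPX hXH hH2 hcoker
      col hcol hJ Z hG hGZ 𝔭 (hc 𝔭 h1 hp𝔭) (hfin 𝔭 h1 hp𝔭) (hES 𝔭 h1 hp𝔭)
    rw [hG₁, lengthAt_quotient_span_singleton_mul G₁ hX0 𝔭] at h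
    have hTfin : lengthAt (IwasawaAlgebra p)
        (IwasawaAlgebra p ⧸ Ideal.span {(PowerSeries.X : IwasawaAlgebra p)}) 𝔭 ≠ ⊤ := by
      rw [lengthAt_quotient_span_singleton PowerSeries.X_prime 𝔭 h1]
      split_ifs <;> simp
    rw [add_comm (lengthAt (IwasawaAlgebra p) (IwasawaAlgebra p ⧸ Ideal.span {PowerSeries.X}) 𝔭)]
      at h
    exact (WithTop.add_le_add_iff_right hTfin).mp h
  obtain ⟨m, hm⟩ :=
    exists_pow_mul_mem_charIdeal_of_lengthAt_le htors (IwasawaAlgebra.prime_C p) hG₁0 hlen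
  refine ⟨m + n, PowerSeries.C (p : ℤ_[p]) ^ m * G₁, hm, ?_⟩
  calc iwasawaToPowerSeries p (PowerSeries.X * (PowerSeries.C (p : ℤ_[p]) ^ m * G₁))
      = iwasawaToPowerSeries p (PowerSeries.C (p : ℤ_[p]) ^ m * G) := by
        rw [hG₁]; ring_nf
    _ = PowerSeries.C ((p : ℚ_[p]) ^ (m + n)) * L := by
        rw [map_mul, map_pow, hιG, PowerSeries.map_C, map_natCast, ← mul_assoc, ← map_pow,
          ← map_mul, ← pow_add]

end Iwasawa

end Kato2004

end Literature.NumberTheory.EllipticCurves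

end
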